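import Mathlib.Analysis.Fourier.FiniteAbelian.PontryaginDuality
import Mathlib.Analysis.SpecialFunctions.Pow.Real
import Literature.Computability.Cryptography.StatisticalDistance
import HarnessLib

/-!
# The XOR lemma for finite abelian groups (Vazirani's XOR lemma)

If a distribution `X` on a finite abelian group `G` has small bias against every nontrivial
character, `|𝔼[ψ(X)]| ≤ ε` for all `ψ ≠ 1`, then `X` is `ε√|G|`-close to the uniform
distribution in statistical (total variation) distance. For `G = 𝔽₂ʳ` the characters are
`z ↦ (-1)^{⟨a, z⟩}` and this is Vazirani's XOR lemma in the form used for parallel-repetition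
("direct product") lower bounds against constant-depth circuits (Watts–Kothari–Schaeffer–Tal
2019, Lemmas 22, 23 and 38; Grewal–Kumar 2024, Lemma 5.31; Grilo–Kashefi–Markham–de Oliveira
2024, Lemma 7); the version over `ℤ₃ᵏ` is used for the `3 Output Mod 3` problem (WKST Thm. 39).

## Main statements

* `PMF.tvDist_uniform_le_of_charBias_le` — the sharp form: for `μ : PMF G` on a finite abelian
  group with `‖∑_x μ(x) ψ(x)‖ ≤ ε` for every nontrivial `ψ : AddChar G ℂ`,
  `tvDist μ uniform ≤ (ε/2)·√|G|`.
* `PMF.xorLemma_abelian` — WKST Lemma 38 as printed (`≤ ε·√|G|`).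
* `PMF.xorLemma_cube` — the Boolean-cube form (WKST Lemma 23 / GK Lemma 5.31): on
  `G = (ι → ZMod 2)`, if `‖∑_z μ(z) (-1)^{⟨a,z⟩}‖ ≤ ε` for all `a ≠ 0` then
  `tvDist μ uniform ≤ ε·√(2^|ι|)`; via `AddChar.eq_neg_one_pow_of_zmod_two` (every character of
  an elementary abelian `2`-group is `z ↦ (-1)^{⟨a,z⟩}`).

## Proof

The printed proof (Goldreich's exposition of Vazirani's lemma; WKST cite [Vaz86]): with
`f(x) = μ(x) − 1/|G|`, orthogonality of characters (`∑_ψ ψ(x) \overline{ψ(y)} = |G|·[x = y]`,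
Mathlib `AddChar.sum_apply_eq_ite`, `AddChar.map_neg_eq_conj`) gives Parseval
`|G| ∑_x f(x)² = ∑_ψ |∑_x f(x)ψ(x)|²`; the `ψ = 0` term vanishes (`∑ f = 0`) and for `ψ ≠ 0`,
`∑_x f(x)ψ(x) = ∑_x μ(x)ψ(x)` (`AddChar.sum_eq_ite`), so `∑ f² ≤ (|Ĝ|−1)ε²/|G| ≤ ε²`
(`AddChar.card_eq`); Cauchy–Schwarz gives `∑|f| ≤ √|G|·ε`, and `tvDist = ½∑|f|`.

## References

* A. Bene Watts, R. Kothari, L. Schaeffer, A. Tal, STOC 2019, arXiv:1906.08890, Lemma 38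
  ("XOR lemma for finite abelian groups"), Lemmas 22–23 (Vazirani's XOR lemma) [WattsEtAl2019].
* S. Grewal, V. M. Kumar, arXiv:2408.16406v3, Lemma 5.31 [GrewalKumar2024].
* O. Goldreich, *Three XOR-Lemmas — An Exposition*, LNCS 6650 (2011) 248–272, §1 (Vazirani's
  XOR lemma, from U. Vazirani, PhD thesis, Berkeley 1986) [Goldreich2011ThreeXorLemmas].

Design: distributions are Mathlib `PMF`s, the distance is the tree's `PMF.tvDist`
(`= ½ ∑ |μ(x) − ν(x)|`, `Literature/Computability/Cryptography/StatisticalDistance.lean`), the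
bias is the complex number `∑_x μ(x) ψ(x)` (`= 𝔼[ψ(X)]`); characters are Mathlib's `AddChar G ℂ`
(trivial character `0`, finitely many: `AddChar.instFintype`). The hypothesis `0 ≤ ε` is needed
only when `G` is trivial (then there is no nontrivial character).
-/

namespace Literature.Probability.Distributions

open Finset Fintype

open scoped ComplexConjugate

section Abelian

variable {G : Type*} [AddCommGroup G] [Fintype G] [DecidableEq G]

/-- Orthogonality of characters summed over the DUAL group, in the form
`∑_ψ ψ(x)·\overline{ψ(y)} = |G|·[x = y]` (Mathlib: `AddChar.sum_apply_eq_ite` and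
`ψ(-y) = \overline{ψ(y)}`). [folklore] -/
private theorem sum_char_mul_conj (x y : G) :
    ∑ ψ : AddChar G ℂ, ψ x * conj (ψ y) = if x = y then (Fintype.card G : ℂ) else 0 := by
  have h : ∀ ψ : AddChar G ℂ, ψ x * conj (ψ y) = ψ (x - y) := fun ψ => by
    rw [← AddChar.map_neg_eq_conj, ← AddChar.map_add_eq_mul, sub_eq_add_neg]
  simp_rw [h, AddChar.sum_apply_eq_ite, sub_eq_zero]

/-- **Parseval for real functions on a finite abelian group**, in inequality-free form:
`|G| · ∑_x f(x)² = ∑_ψ ‖∑_x f(x) ψ(x)‖²`. [folklore] -/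
private theorem card_mul_sum_sq_eq (f : G → ℝ) :
    (Fintype.card G : ℝ) * ∑ x, f x ^ 2 = ∑ ψ : AddChar G ℂ, ‖∑ x, (f x : ℂ) * ψ x‖ ^ 2 := by
  -- work in `ℂ`
  have key : ∀ ψ : AddChar G ℂ, ((‖∑ x, (f x : ℂ) * ψ x‖ ^ 2 : ℝ) : ℂ) =
      ∑ x, ∑ y, (f x : ℂ) * (f y : ℂ) * (ψ x * conj (ψ y)) := by
    intro ψ
    rw [← Complex.normSq_eq_norm_sq, Complex.normSq_eq_conj_mul_self, map_sum, Finset.sum_mul]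
    simp_rw [Finset.mul_sum, map_mul, Complex.conj_ofReal]
    rw [Finset.sum_comm]
    refine Finset.sum_congr rfl fun x _ => Finset.sum_congr rfl fun y _ => ?_
    ring
  apply Complex.ofReal_injective
  rw [Complex.ofReal_mul, Complex.ofReal_sum, Complex.ofReal_sum]
  simp_rw [key]
  -- `∑_ψ ∑_x ∑_y = ∑_x ∑_y ∑_ψ`, then orthogonality collapses `y = x`
  rw [Finset.sum_comm]
  have inner : ∀ x : G, ∑ ψ : AddChar G ℂ, ∑ y, (f x : ℂ) * (f y : ℂ) * (ψ x * conj (ψ y)) =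
      (Fintype.card G : ℂ) * ((f x ^ 2 : ℝ) : ℂ) := by
    intro x
    rw [Finset.sum_comm]
    simp_rw [← Finset.mul_sum, sum_char_mul_conj, mul_ite, mul_zero]
    rw [Finset.sum_ite_eq]
    simp only [Finset.mem_univ, if_true, Complex.ofReal_pow]
    ring
  simp_rw [inner, ← Finset.mul_sum, Complex.ofReal_natCast]

/-- **XOR lemma for finite abelian groups, sharp form.** If a distribution `μ` on a finite
abelian group `G` satisfies `‖∑_x μ(x) ψ(x)‖ ≤ ε` (i.e. `|𝔼[ψ(X)]| ≤ ε`) for every nontrivial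
character `ψ`, then its total variation distance from uniform is at most `(ε/2)·√|G|`
(Watts–Kothari–Schaeffer–Tal 2019, Lemma 38, whose printed bound `ε√|G|` follows;
Goldreich 2011, §1). [cite: WattsEtAl2019, Lemma 38] -/
theorem _root_.PMF.tvDist_uniform_le_of_charBias_le (μ : PMF G) {ε : ℝ} (hε : 0 ≤ ε)
    (h : ∀ ψ : AddChar G ℂ, ψ ≠ 0 → ‖∑ x, ((μ x).toReal : ℂ) * ψ x‖ ≤ ε) :
    μ.tvDist (PMF.uniformOfFintype G) ≤ ε / 2 * Real.sqrt (Fintype.card G) := by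
  classical
  set N : ℕ := Fintype.card G with hN
  have hNpos : 0 < (N : ℝ) := by exact_mod_cast Fintype.card_pos
  set f : G → ℝ := fun x => (μ x).toReal - (N : ℝ)⁻¹ with hf
  -- (1) the distance is `½ ∑ |f|`
  have htv : μ.tvDist (PMF.uniformOfFintype G) = 2⁻¹ * ∑ x, |f x| := by
    rw [PMF.tvDist, tsum_fintype]
    congr 1
    refine Finset.sum_congr rfl fun x _ => ?_
    rw [PMF.uniformOfFintype_apply, ENNReal.toReal_inv, ENNReal.toReal_natCast]
  -- (2) `∑ μ = 1`, hence `∑ f = 0`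
  have hsumμ : ∑ x, (μ x).toReal = 1 := by
    rw [← ENNReal.toReal_sum fun x _ => PMF.apply_ne_top μ x]
    have h1 : ∑ x, μ x = 1 := by
      have h2 := μ.tsum_coe
      rwa [tsum_fintype] at h2
    rw [h1, ENNReal.toReal_one]
  have hsumf : ∑ x, f x = 0 := by
    simp only [hf, Finset.sum_sub_distrib, hsumμ, Finset.sum_const, Finset.card_univ,
      nsmul_eq_mul]
    rw [← hN, mul_inv_cancel₀ hNpos.ne']
    ring
  -- (3) the Fourier coefficients of `f`: `0` at the trivial character, the bias elsewhere
  have hcoef0 : ∑ x, (f x : ℂ) * (0 : AddChar G ℂ) x = 0 := by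
    simp only [AddChar.zero_apply, mul_one]
    rw [← Complex.ofReal_sum, hsumf, Complex.ofReal_zero]
  have hcoef : ∀ ψ : AddChar G ℂ, ψ ≠ 0 →
      ∑ x, (f x : ℂ) * ψ x = ∑ x, ((μ x).toReal : ℂ) * ψ x := by
    intro ψ hψ
    have hψsum : ∑ x, ψ x = 0 := AddChar.sum_eq_zero_iff_ne_zero.2 hψ
    simp only [hf, Complex.ofReal_sub, sub_mul, Finset.sum_sub_distrib]
    rw [← Finset.mul_sum, hψsum, mul_zero, sub_zero]
  -- (4) Parseval + the bias bounds: `N ∑ f² ≤ (N - 1) ε² ≤ N ε²`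
  have hpars := card_mul_sum_sq_eq f
  have hbound : ∑ ψ : AddChar G ℂ, ‖∑ x, (f x : ℂ) * ψ x‖ ^ 2 ≤ (N : ℝ) * ε ^ 2 := by
    calc ∑ ψ : AddChar G ℂ, ‖∑ x, (f x : ℂ) * ψ x‖ ^ 2
        ≤ ∑ _ψ : AddChar G ℂ, ε ^ 2 := by
          refine Finset.sum_le_sum fun ψ _ => ?_
          by_cases hψ : ψ = 0
          · subst hψ; rw [hcoef0, norm_zero, zero_pow two_ne_zero]; positivity
          · rw [hcoef ψ hψ]
            exact pow_le_pow_left₀ (norm_nonneg _) (h ψ hψ) 2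
      _ = (N : ℝ) * ε ^ 2 := by
          rw [Finset.sum_const, Finset.card_univ, AddChar.card_eq, nsmul_eq_mul]
  have hf2 : ∑ x, f x ^ 2 ≤ ε ^ 2 := by
    have := hpars ▸ hbound
    exact le_of_mul_le_mul_left (by linarith) hNpos
  -- (5) Cauchy–Schwarz: `(∑ |f|)² ≤ N ∑ f²`
  have hcs : (∑ x, |f x|) ^ 2 ≤ (N : ℝ) * ∑ x, f x ^ 2 := by
    have := Finset.sum_mul_sq_le_sq_mul_sq (Finset.univ : Finset G) (fun _ => (1 : ℝ))
      (fun x => |f x|)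
    simp only [one_mul, one_pow, Finset.sum_const, Finset.card_univ, nsmul_eq_mul, mul_one,
      sq_abs] at this
    rw [hN]; exact this
  have hsum_abs : ∑ x, |f x| ≤ Real.sqrt N * ε := by
    have h1 : (∑ x, |f x|) ^ 2 ≤ (Real.sqrt N * ε) ^ 2 := by
      rw [mul_pow, Real.sq_sqrt hNpos.le]
      exact hcs.trans (mul_le_mul_of_nonneg_left hf2 hNpos.le)
    exact (pow_le_pow_iff_left₀ (Finset.sum_nonneg fun x _ => abs_nonneg (f x))
      (by positivity) two_ne_zero).1 h1
  -- (6) conclude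
  rw [htv]
  calc 2⁻¹ * ∑ x, |f x| ≤ 2⁻¹ * (Real.sqrt N * ε) :=
        mul_le_mul_of_nonneg_left hsum_abs (by norm_num)
    _ = ε / 2 * Real.sqrt N := by ring

/-- **XOR lemma for finite abelian groups, as printed** (Watts–Kothari–Schaeffer–Tal 2019,
Lemma 38): "Let `X` be a distribution on a finite abelian group `G` such that `|𝔼[ψ(X)]| ≤ ε` for
every non-trivial character `ψ`. Then `X` is `ε√|G|` close (in statistical distance) to the
uniform distribution over `G`." [cite: WattsEtAl2019, Lemma 38] -/
theorem _root_.PMF.xorLemma_abelian (μ : PMF G) {ε : ℝ} (hε : 0 ≤ ε)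
    (h : ∀ ψ : AddChar G ℂ, ψ ≠ 0 → ‖∑ x, ((μ x).toReal : ℂ) * ψ x‖ ≤ ε) :
    μ.tvDist (PMF.uniformOfFintype G) ≤ ε * Real.sqrt (Fintype.card G) :=
  (μ.tvDist_uniform_le_of_charBias_le hε h).trans
    (mul_le_mul_of_nonneg_right (by linarith) (Real.sqrt_nonneg _))

end Abelian

/-! ### The Boolean cube: characters are `z ↦ (-1)^{Σ_{i ∈ S} zᵢ}` -/

section Cube

variable {ι : Type*} [Fintype ι] [DecidableEq ι]

/-- An additive character turns finite sums into products. [folklore] -/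
private theorem addChar_map_finset_sum {A M : Type*} [AddCommMonoid A] [CommMonoid M]
    (ψ : AddChar A M) {κ : Type*} (s : Finset κ) (g : κ → A) :
    ψ (∑ k ∈ s, g k) = ∏ k ∈ s, ψ (g k) := by
  classical
  induction s using Finset.induction_on with
  | empty => simp [AddChar.map_zero_eq_one]
  | insert a s ha ih => rw [Finset.sum_insert ha, Finset.prod_insert ha, AddChar.map_add_eq_mul, ih]

/-- The sign character of the Boolean cube `𝔽₂^ι` attached to a set `S` of coordinates:
`χ_S(z) = (-1)^{Σ_{i∈S} zᵢ}`. [cite: WattsEtAl2019, Lemma 23] -/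
def cubeChar (S : Finset ι) (z : ι → ZMod 2) : ℂ := (-1) ^ (∑ i ∈ S, (z i).val)

/-- **Every character of `𝔽₂^ι` is a sign character**: for `ψ : AddChar (ι → ZMod 2) ℂ` and
`S = {i | ψ(eᵢ) ≠ 1}` one has `ψ(z) = (-1)^{Σ_{i∈S} zᵢ}`; moreover `S ≠ ∅` if `ψ ≠ 0`
(each `ψ(eᵢ)` is a square root of `ψ(2eᵢ) = ψ(0) = 1`). This is the standard description of
the characters of `𝔽₂ⁿ` as the parity functions `χ_S` (O'Donnell 2014, Ch. 1, §1.4 "characters";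
it is the dictionary between WKST's Lemma 38 and Lemma 23). [cite: ODonnell2014, §1.4] -/
theorem _root_.AddChar.eq_cubeChar (ψ : AddChar (ι → ZMod 2) ℂ) :
    ∃ S : Finset ι, (ψ ≠ 0 → S.Nonempty) ∧ ∀ z, ψ z = cubeChar S z := by
  classical
  -- the values on the basis vectors are `±1`
  have hsq : ∀ i, ψ (Pi.single i 1) = 1 ∨ ψ (Pi.single i 1) = -1 := by
    intro i
    apply mul_self_eq_one_iff.1
    rw [← AddChar.map_add_eq_mul, ← Pi.single_add]
    have : (1 : ZMod 2) + 1 = 0 := by decide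
    rw [this, Pi.single_zero, AddChar.map_zero_eq_one]
  refine ⟨Finset.univ.filter fun i => ψ (Pi.single i 1) ≠ 1, fun hψ => ?_, fun z => ?_⟩
  · -- nonempty: otherwise `ψ = 0`
    by_contra hS
    rw [Finset.not_nonempty_iff_eq_empty, Finset.filter_eq_empty_iff] at hS
    apply hψ
    refine AddChar.ext _ _ fun z => ?_
    rw [AddChar.zero_apply, ← Finset.univ_sum_single z, addChar_map_finset_sum]
    refine Finset.prod_eq_one fun i _ => ?_
    have hzi : Pi.single i (z i) = (z i).val • (Pi.single i (1 : ZMod 2) : ι → ZMod 2) := by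
      rw [← Pi.single_smul, nsmul_eq_mul, mul_one, ZMod.natCast_zmod_val]
    rw [hzi, AddChar.map_nsmul_eq_pow, Decidable.not_not.1 (hS (Finset.mem_univ i)), one_pow]
  · -- the formula
    rw [cubeChar, ← Finset.prod_pow_eq_pow_sum, Finset.prod_filter]
    conv_lhs => rw [← Finset.univ_sum_single z, addChar_map_finset_sum]
    refine Finset.prod_congr rfl fun i _ => ?_
    have hzi : Pi.single i (z i) = (z i).val • (Pi.single i (1 : ZMod 2) : ι → ZMod 2) := by
      rw [← Pi.single_smul, nsmul_eq_mul, mul_one, ZMod.natCast_zmod_val]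
    rw [hzi, AddChar.map_nsmul_eq_pow]
    rcases hsq i with h1 | h1
    · simp [h1]
    · rw [if_pos (by rw [h1]; norm_num), h1]

/-- **Vazirani's XOR lemma on the Boolean cube** (Watts–Kothari–Schaeffer–Tal 2019, Lemma 23;
Grewal–Kumar 2024, Lemma 5.31; Goldreich 2011, §1): if a distribution `μ` on `𝔽₂^ι` has
`|𝔼[(-1)^{Σ_{i∈S} X_i}]| ≤ ε` for every nonempty set `S` of coordinates, then `μ` is
`ε·√(2^{|ι|})`-close to uniform in total variation distance (in fact `(ε/2)√(2^{|ι|})`-close).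
[cite: WattsEtAl2019, Lemma 23] -/
theorem _root_.PMF.xorLemma_cube (μ : PMF (ι → ZMod 2)) {ε : ℝ} (hε : 0 ≤ ε)
    (h : ∀ S : Finset ι, S.Nonempty → ‖∑ z, ((μ z).toReal : ℂ) * cubeChar S z‖ ≤ ε) :
    μ.tvDist (PMF.uniformOfFintype (ι → ZMod 2)) ≤ ε / 2 * Real.sqrt (2 ^ Fintype.card ι) := by
  have hcard : (Fintype.card (ι → ZMod 2) : ℝ) = 2 ^ Fintype.card ι := by
    rw [Fintype.card_fun, ZMod.card]; push_cast; ring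
  rw [← hcard]
  refine μ.tvDist_uniform_le_of_charBias_le hε fun ψ hψ => ?_
  obtain ⟨S, hS, hψS⟩ := ψ.eq_cubeChar
  simp_rw [hψS]
  exact h S (hS hψ)

end Cube

end Literature.Probability.Distributions
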